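import Literature.AlgebraicGeometry.Limits.LocalizationRelativeGroupSpread
import Literature.AlgebraicGeometry.Limits.LocalizationActionSpread
import HarnessLib

/-!
# A FINITE family of morphisms on the generic base change of stage objects spreads to ONE common finer stage, and is determined there
# (EGA IV₃ 8.8.2 (i) over the relative base `P ⊗ D(t)`, finite-family form; the SPREAD-SEQUEL core (s1) of the hodgecm `stub_RGD` road)

Topic `Literature/AlgebraicGeometry/Limits`, namespace `Literature.AlgebraicGeometry.Limits.LocApprox`.  THEOREMS ONLY (no definition, no named
fact, no instance, no notation, no `sorry`).  Sequel of ★ `Limits/LocalizationRelativeGroupSpread` (A-p01 (g25): the relative leg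
`relLeg ρ : P ⊗ Spec B ⟶ P ⊗ D(s)` over `P ⊗ D(t)`, RELATIVE 8.8.2 (i) `exists_whiskerLeft_relLeg_comp_eq`, schematic dominance of the relative
leg) and ★ `Limits/SliceBaseChange` ∕ `GroupLawTransferAlong` (the dictionary `sliceHom`∕`unsliceHom`, `OverFac.facObjIso`,
`pullback_map_sliceHom`).  Cell `hodgecm-mathlib` (D-0151), FLOOR 0, P6 «MOD programme» (crux hLiu418 = stmt-HodgeConjecture-24832), SPREAD
door: deal «SPREAD SEQUELS (s1)–(s3)» (LEAD F0P6-plan (g2) 2026-09-01 21:22:30Z; B-p18 (g37)) — this file is the common core of (s1) (spread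
the `n` endomorphisms `ι(b_j)` of a ring action) and (s2-λ) (spread the polarization homomorphism `λ`): a finite family of morphisms between the
GENERIC base changes of two stage objects `Y`, `Z` over `P ⊗ D(t)` spreads to morphisms between their restrictions to ONE finer stage
`P ⊗ D(s)`, compatibly with the canonical identifications `(Yₛ)_B ≅ Y_B`; and over a flat stage two such spreadings agree as soon as they
agree generically.  HC_CM is proved only modulo the printed citations until rung 0 closes; this file is generic and changes no count.

* §1 **`exists_stage_homs_of_generic`** — `ψ_j : Y_B ⟶ Z_B` (`j ∈ J` finite, `Y` qc∕qs and `Z` l.f.p. over `P ⊗ D(t)`, `P` qc∕qs over `A`) ⇒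
  `∃ s (σ : s ⟶ t) (z_j : Yₛ ⟶ Zₛ)` with `(z_j)_B ≫ (Zₛ)_B ≅ Z_B = (Yₛ)_B ≅ Y_B ≫ ψ_j` (★ relative 8.8.2 (i) per index, ★
  `LocalizationActionSpread.exists_hom_forall` for the common refinement, ★ `relLeg_comp_stageMap`, ★ `pullback_map_sliceHom`).
* §2 **`stage_hom_eq_of_generic_eq`** — `A` a domain, `B = Frac A`: over a stage `s` with `P ⊗ D(s) → D(s)` flat, two morphisms `Yₛ ⟶ Zₛ`
  (`Yₛ` flat, `Zₛ` separated over the stage) with the same base change to `P ⊗ Spec B` are EQUAL (★ `pullback_map_injective_of_flat` along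
  the scheme-theoretically dominant relative leg) — the «identities transfer to the stage» step.

## References
* [EGAIV3] A. Grothendieck, J. Dieudonné, *EGA IV₃* (1966), Thm. 8.8.2 (i); 11.10.5.
* [StacksProject] The Stacks Project, Tag 01ZC.
* [GortzWedhorn2020] U. Görtz, T. Wedhorn, *Algebraic Geometry I*, 2nd ed. (2020), Thm. 10.57, Cor. 10.64, §(4.7) (4.7.1) and Prop. 4.16.
-/

set_option autoImplicit false

noncomputable section

universe u

open CategoryTheory CategoryTheory.Limits AlgebraicGeometry MonoidalCategory CartesianMonoidalCategory

namespace Literature.AlgebraicGeometry.Limits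

namespace LocApprox

open Literature.AlgebraicGeometry.Motives (SchemeOver specOver)
open Literature.AlgebraicGeometry.Limits.OverFac

set_option backward.isDefEq.respectTransparency false

/-! ## §1 A finite family of generic morphisms spreads to one common stage -/

section Spread

variable {A : Type u} [CommRing A] {S : Submonoid A} (B : Type u) [CommRing B] [Algebra A B] [IsLocalization S B]
  {P : SchemeOver A} [QuasiCompact P.hom] [QuasiSeparated P.hom] {t : Idx S}

/-- **A FINITE FAMILY OF MORPHISMS `ψ_j : Y_B ⟶ Z_B` BETWEEN GENERIC BASE CHANGES SPREADS TO ONE COMMON STAGE**: there are a finer stage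
`σ : s ⟶ t` and morphisms `z_j : Yₛ ⟶ Zₛ` over `P ⊗ D(s)` (`Yₛ = Y ×_{P ⊗ D(t)} (P ⊗ D(s))`) whose base change along the relative leg is
`ψ_j` through the canonical identifications `(Yₛ)_B ≅ Y_B`, `(Zₛ)_B ≅ Z_B` (★ `OverFac.facObjIso`).  (EGA IV₃ 8.8.2 (i) over the relative
base, per index by ★ `exists_whiskerLeft_relLeg_comp_eq`, then a common refinement of the finitely many stages.)
[cite: EGAIV3, Thm. 8.8.2 (i)] [cite: StacksProject, Tag 01ZC] [cite: GortzWedhorn2020, Thm. 10.57 and Cor. 10.64] -/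
theorem exists_stage_homs_of_generic (Y Z : Over (P ⊗ (baseDiagram S).obj t).left) [QuasiCompact Y.hom] [QuasiSeparated Y.hom]
    [LocallyOfFinitePresentation Z.hom] {J : Type*} [Finite J]
    (ψ : J → ((Over.pullback (genOver S B P t).hom).obj Y ⟶ (Over.pullback (genOver S B P t).hom).obj Z)) :
    ∃ (s : Idx S) (σ : s ⟶ t)
      (z : J → ((Over.pullback (stageOver S P σ).hom).obj Y ⟶ (Over.pullback (stageOver S P σ).hom).obj Z)),
      ∀ j, (Over.pullback (relLeg S B P σ).left).map (z j) ≫ (facObjIso (relLeg S B P σ) Z).hom =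
        (facObjIso (relLeg S B P σ) Y).hom ≫ ψ j := by
  -- 8.8.2 (i) per index
  choose sj ρj gj hgj using fun j => exists_whiskerLeft_relLeg_comp_eq B Y Z (unsliceHom (genOver S B P t) (ψ j))
  -- a common refinement of the `s j` and of `t`
  obtain ⟨s, hs⟩ := exists_hom_forall (S := S) (fun o : Option J => o.elim t sj)
  let σ : s ⟶ t := (hs none).some
  have τ : ∀ j, s ⟶ sj j := fun j => (hs (some j)).some
  refine ⟨s, σ, fun j => sliceHom (stageOver S P σ) ((Y ◁ stageMap S P (τ j) (ρj j) σ) ≫ gj j), fun j => ?_⟩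
  have e := pullback_map_sliceHom (relLeg S B P σ) (P := Z) ((Y ◁ stageMap S P (τ j) (ρj j) σ) ≫ gj j)
  rw [← Category.assoc, ← MonoidalCategory.whiskerLeft_comp, relLeg_comp_stageMap, hgj, sliceHom_unsliceHom] at e
  exact e

end Spread

/-! ## §2 Over a flat stage a morphism is determined by its generic base change -/

section Unique

variable {A : Type u} [CommRing A] [IsDomain A] (K : Type u) [Field K] [Algebra A K] [IsFractionRing A K]
  {P : SchemeOver A} {s t : Idx (nonZeroDivisors A)} (σ : s ⟶ t)

/-- **TWO STAGE MORPHISMS WITH THE SAME GENERIC BASE CHANGE ARE EQUAL** (`A` a domain, `K = Frac A`, the stage `P ⊗ D(s) → D(s)` flat,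
`Yₛ` flat and `Zₛ` separated over `P ⊗ D(s)`): base change along the relative leg `P ⊗ Spec K ⟶ P ⊗ D(s)` — quasi-compact and scheme-
theoretically dominant (★ `quasiCompact_relLeg_left`, ★ `isSchemeTheoreticallyDominant_relLeg_left`) — is injective on morphisms from flat to
separated schemes (★ `pullback_map_injective_of_flat`; EGA IV₃ 11.10.5).  This is how identities proved generically transfer to the stage.
[cite: EGAIV3, 11.10.5] [cite: GortzWedhorn2020, Prop. 9.19 and Rem. 9.20] -/
theorem stage_hom_eq_of_generic_eq [Flat (pullback.snd P.hom ((baseDiagram (nonZeroDivisors A)).obj s).hom)]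
    {Yₛ Zₛ : Over (stageOver (nonZeroDivisors A) P σ).left} [Flat Yₛ.hom] [IsSeparated Zₛ.hom] (z z' : Yₛ ⟶ Zₛ)
    (h : (Over.pullback (relLeg (nonZeroDivisors A) K P σ).left).map z = (Over.pullback (relLeg (nonZeroDivisors A) K P σ).left).map z') :
    z = z' := by
  haveI : IsSchemeTheoreticallyDominant (leg (nonZeroDivisors A) K s).left :=
    Literature.NumberTheory.EllipticCurves.isSchemeTheoreticallyDominant_leg_left K s
  haveI : QuasiCompact (relLeg (nonZeroDivisors A) K P σ).left := quasiCompact_relLeg_left (nonZeroDivisors A) K P σ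
  haveI : IsSchemeTheoreticallyDominant (relLeg (nonZeroDivisors A) K P σ).left :=
    isSchemeTheoreticallyDominant_relLeg_left (nonZeroDivisors A) K P σ
  exact pullback_map_injective_of_flat (relLeg (nonZeroDivisors A) K P σ).left h

end Unique

end LocApprox

end Literature.AlgebraicGeometry.Limits

end
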